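import Mathlib.Algebra.MvPolynomial.Basic
import Mathlib.Algebra.MvPolynomial.Eval
import Mathlib.Data.Complex.Basic
import Mathlib.Logic.Equiv.Fin.Basic
import Mathlib.Tactic.LinearCombination
import Mathlib.Tactic.FinCases

/-!
# `codim Sing(per₄) ≥ 7`: the explicit section `W` (definitions `gList`, `G`)

THE SECTION `W ⊂ ℂ^{4×4}`: graph form over the pivots `m₀₀, m₁₁, m₂₂, m₃₃, m₀₁, m₁₂, m₂₃` with `±1` coefficients
(found by a hub-local random search, `sect/W_best.json`, so that all 34 anti-block / cross branches are rank-7 linear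
systems and all 8 zero-line branches have 3-variable Nullstellensatz certificates — the leaves `…HeightLeaves*`).
`gList`/`G` = the nine linear forms (one per non-pivot entry), `G_card`, `G_constantCoeff`, `inW_eqs` (a point killed
by `G` lies on `W`), `fin_zero` (a point of `W` with zero pivots is `0`).

This is the ONE definitions-carrying file of the series (review lane): `gList`, `G` are bookkeeping names for an
explicit list of nine linear forms, not vendored facts.

Helper for crux `CoverDecancellation` (stmt-ValiantsHypothesis-17819): part of the proof of
`codim Sing(per₄) ≥ 7` = `7 ≤ (VonZurGathen.singPermIdeal ℂ 4).height`, the input `h7` of the (4,2) lower rung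
`StrengthTwoPerFourGeFour` («str₂(per₄) ≥ 4», `PolyaContinuedLaplaceRigidity.Strength.strengthTwoPerFourGeFour_of_seven_le_height`).
See `Cruxes/CoverDecancellation/Lines/sing_per4_support.md` and the assembled workfile `Lines/sing_per4_height.lean`.
val-idea-10 g2, 2026-08-28.  No `sorry`; definitions `gList`, `G` only.
-/

set_option linter.dupNamespace false

namespace Summit.ValiantsHypothesis.ValiantsHypothesis.Theorems.SymPencilPerFourSingularLocusHeightSectionW

open MvPolynomial

/-- The nine linear forms cutting out the section `W` (one per non-pivot entry). -/
noncomputable def gList : List (MvPolynomial (Fin 4 × Fin 4) ℂ) :=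
  [X (0, 2) - (X (0, 1) + X (0, 0) - X (3, 3) - X (1, 2)),
   X (0, 3) - (-X (2, 3) - X (1, 1) - X (0, 0) + X (3, 3)),
   X (1, 0) - (X (2, 3) - X (1, 1) - X (0, 1) + X (1, 2)),
   X (1, 3) - (-X (1, 2) + X (0, 0) + X (3, 3) - X (2, 2)),
   X (2, 0) - (X (1, 1) + X (2, 3) + X (2, 2) - X (0, 0)),
   X (2, 1) - (X (2, 2) - X (2, 3) - X (0, 1) - X (0, 0)),
   X (3, 0) - (-X (1, 1) + X (0, 0) + X (3, 3) - X (2, 2)),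
   X (3, 1) - (-X (0, 0) - X (1, 1) - X (2, 3) - X (1, 2)),
   X (3, 2) - (-X (2, 2) + X (3, 3) + X (0, 0) - X (0, 1))]

/-- The section's forms as a finset. -/
noncomputable def G : Finset (MvPolynomial (Fin 4 × Fin 4) ℂ) := gList.toFinset

/-- At most nine forms. -/
theorem G_card : G.card ≤ 9 := (List.toFinset_card_le gList).trans (by simp [gList])

/-- No constant terms. -/
theorem G_constantCoeff : ∀ g ∈ G, constantCoeff g = 0 := by
  intro g hg
  simp only [G, List.mem_toFinset, gList, List.mem_cons, List.mem_nil_iff, or_false] at hg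
  rcases hg with rfl | rfl | rfl | rfl | rfl | rfl | rfl | rfl | rfl <;> simp [constantCoeff_X]

/-- A point killed by the nine forms lies on `W`: its non-pivot entries are the forms of the pivots. -/
theorem inW_eqs (x : Fin 4 × Fin 4 → ℂ) (hG0 : ∀ g ∈ G, eval x g = 0) :
    x (0, 2) = x (0, 1) + x (0, 0) - x (3, 3) - x (1, 2) ∧
    x (0, 3) = -x (2, 3) - x (1, 1) - x (0, 0) + x (3, 3) ∧
    x (1, 0) = x (2, 3) - x (1, 1) - x (0, 1) + x (1, 2) ∧
    x (1, 3) = -x (1, 2) + x (0, 0) + x (3, 3) - x (2, 2) ∧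
    x (2, 0) = x (1, 1) + x (2, 3) + x (2, 2) - x (0, 0) ∧
    x (2, 1) = x (2, 2) - x (2, 3) - x (0, 1) - x (0, 0) ∧
    x (3, 0) = -x (1, 1) + x (0, 0) + x (3, 3) - x (2, 2) ∧
    x (3, 1) = -x (0, 0) - x (1, 1) - x (2, 3) - x (1, 2) ∧
    x (3, 2) = -x (2, 2) + x (3, 3) + x (0, 0) - x (0, 1) := by
  have h0 : eval x (X (0, 2) - (X (0, 1) + X (0, 0) - X (3, 3) - X (1, 2))) = 0 :=
    hG0 _ (List.mem_toFinset.2 (by simp [gList]))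
  have h1 : eval x (X (0, 3) - (-X (2, 3) - X (1, 1) - X (0, 0) + X (3, 3))) = 0 :=
    hG0 _ (List.mem_toFinset.2 (by simp [gList]))
  have h2 : eval x (X (1, 0) - (X (2, 3) - X (1, 1) - X (0, 1) + X (1, 2))) = 0 :=
    hG0 _ (List.mem_toFinset.2 (by simp [gList]))
  have h3 : eval x (X (1, 3) - (-X (1, 2) + X (0, 0) + X (3, 3) - X (2, 2))) = 0 :=
    hG0 _ (List.mem_toFinset.2 (by simp [gList]))
  have h4 : eval x (X (2, 0) - (X (1, 1) + X (2, 3) + X (2, 2) - X (0, 0))) = 0 :=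
    hG0 _ (List.mem_toFinset.2 (by simp [gList]))
  have h5 : eval x (X (2, 1) - (X (2, 2) - X (2, 3) - X (0, 1) - X (0, 0))) = 0 :=
    hG0 _ (List.mem_toFinset.2 (by simp [gList]))
  have h6 : eval x (X (3, 0) - (-X (1, 1) + X (0, 0) + X (3, 3) - X (2, 2))) = 0 :=
    hG0 _ (List.mem_toFinset.2 (by simp [gList]))
  have h7 : eval x (X (3, 1) - (-X (0, 0) - X (1, 1) - X (2, 3) - X (1, 2))) = 0 :=
    hG0 _ (List.mem_toFinset.2 (by simp [gList]))
  have h8 : eval x (X (3, 2) - (-X (2, 2) + X (3, 3) + X (0, 0) - X (0, 1))) = 0 :=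
    hG0 _ (List.mem_toFinset.2 (by simp [gList]))
  simp only [map_sub, map_add, map_neg, eval_X] at h0 h1 h2 h3 h4 h5 h6 h7 h8
  exact ⟨by linear_combination h0, by linear_combination h1, by linear_combination h2, by linear_combination h3, by linear_combination h4, by linear_combination h5, by linear_combination h6, by linear_combination h7, by linear_combination h8⟩

/-- On `W`, vanishing of the seven pivots is vanishing of the matrix. -/
theorem fin_zero (x : Fin 4 × Fin 4 → ℂ)
    (n02 : x (0, 2) = x (0, 1) + x (0, 0) - x (3, 3) - x (1, 2)) (n03 : x (0, 3) = -x (2, 3) - x (1, 1) - x (0, 0) + x (3, 3)) (n10 : x (1, 0) = x (2, 3) - x (1, 1) - x (0, 1) + x (1, 2)) (n13 : x (1, 3) = -x (1, 2) + x (0, 0) + x (3, 3) - x (2, 2)) (n20 : x (2, 0) = x (1, 1) + x (2, 3) + x (2, 2) - x (0, 0)) (n21 : x (2, 1) = x (2, 2) - x (2, 3) - x (0, 1) - x (0, 0)) (n30 : x (3, 0) = -x (1, 1) + x (0, 0) + x (3, 3) - x (2, 2)) (n31 : x (3, 1) = -x (0, 0) - x (1, 1) - x (2, 3) - x (1, 2))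 (n32 : x (3, 2) = -x (2, 2) + x (3, 3) + x (0, 0) - x (0, 1))
    (h : x (0, 0) = 0 ∧ x (1, 1) = 0 ∧ x (2, 2) = 0 ∧ x (3, 3) = 0 ∧ x (0, 1) = 0 ∧ x (1, 2) = 0 ∧ x (2, 3) = 0) : x = 0 := by
  obtain ⟨p0, p1, p2, p3, p4, p5, p6⟩ := h
  funext c
  simp only [Pi.zero_apply]
  rcases c with ⟨i, j⟩
  fin_cases i <;> fin_cases j
  · exact p0
  · exact p4
  · exact n02.trans (by linear_combination (1 : ℂ) * p4 + (1 : ℂ) * p0 + (-1 : ℂ) * p3 +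
      (-1 : ℂ) * p5)
  · exact n03.trans (by linear_combination (-1 : ℂ) * p6 + (-1 : ℂ) * p1 + (-1 : ℂ) * p0 +
      (1 : ℂ) * p3)
  · exact n10.trans (by linear_combination (1 : ℂ) * p6 + (-1 : ℂ) * p1 + (-1 : ℂ) * p4 +
      (1 : ℂ) * p5)
  · exact p1
  · exact p5
  · exact n13.trans (by linear_combination (-1 : ℂ) * p5 + (1 : ℂ) * p0 + (1 : ℂ) * p3 +
      (-1 : ℂ) * p2)
  · exact n20.trans (by linear_combination (1 : ℂ) * p1 + (1 : ℂ) * p6 + (1 : ℂ) * p2 +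
      (-1 : ℂ) * p0)
  · exact n21.trans (by linear_combination (1 : ℂ) * p2 + (-1 : ℂ) * p6 + (-1 : ℂ) * p4 +
      (-1 : ℂ) * p0)
  · exact p2
  · exact p6
  · exact n30.trans (by linear_combination (-1 : ℂ) * p1 + (1 : ℂ) * p0 + (1 : ℂ) * p3 +
      (-1 : ℂ) * p2)
  · exact n31.trans (by linear_combination (-1 : ℂ) * p0 + (-1 : ℂ) * p1 + (-1 : ℂ) * p6 +
      (-1 : ℂ) * p5)
  · exact n32.trans (by linear_combination (-1 : ℂ) * p2 + (1 : ℂ) * p3 + (1 : ℂ) * p0 +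
      (-1 : ℂ) * p4)
  · exact p3

end Summit.ValiantsHypothesis.ValiantsHypothesis.Theorems.SymPencilPerFourSingularLocusHeightSectionW
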